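import Literature.NumberTheory.Automorphic.U3SupercuspFormUnipotentIntegral   -- ★ p852769 (this seat): §1 generic Jacquet lemma with a measure, §2 model exhaustion
import Literature.NumberTheory.Automorphic.CMLocalNonsplitBorelTransport       -- ★ `localNonsplitEquiv_mem_unipotentU_iff` (radical ↔ radical); brings ★ `u3_isSupercuspidal_iff_jacquet_eq_zero_mp`
import HarnessLib

/-!
# Matrix coefficients of supercuspidal representations of `U(Φ₃)(L⁺_v)` are supercusp forms — the CM reading at `Gqs L v`

Topic `NumberTheory/Rogawski1990`; namespace `Literature.NumberTheory.Rogawski1990`.  THEOREMS ONLY (no definition, no named fact, no instance, no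
notation, no `sorry`).  Cell `pub/hodgecm-mathlib`, crux H413 = `stmt-HodgeConjecture-24833` (`--supports` lane), CENSUS «HC-SC» v1 (F0P3a-p02 (g26)) §2
brick **E2-3a «U3-CUSP-FORM» part 2**, the statement AS CENSUSED — at the quasi-split CM avatar ★ `Gqs L v = U(Φ₃)(L⁺_v)` of a non-split finite
place `v`, along the radical `N = (cmBorelTriple L 3 v).N` with ANY right-invariant Borel measure finite on compacta (e.g. the Haar measure `μ_N` of ★
`UnitaryGroupTorusOrbitalIntegralCanonical.classOrbitalIntegral_eq_smul_integral_prod_of_torus_regular`, the Iwasawa reading of split-regular orbital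
integrals — census E2-3b's consumer).  LEAD F0P3a-plan (g15) T14-62 (1) «GO-LOW».  HONEST LABEL: count-neutral generic brick; HC_CM is proved only
modulo the 7 printed citations (2 remaining named inputs hLiu418 = stmt-HodgeConjecture-24832, h413 = stmt-HodgeConjecture-24833) until rung 0 closes.

THE MATHEMATICS.  No measure is transported: §1 of ★ `U3SupercuspFormUnipotentIntegral` (Jacquet's first lemma against a right-invariant measure and
the passage to the full integral along an exhausting sequence of compact open subgroups) is stated for ANY topological group; `V = V(N)` at `Gqs L v` is
★ `Rogawski1990.u3_isSupercuspidal_iff_jacquet_eq_zero_mp` (Harish-Chandra's criterion ⇒, Casselman's argument); and the exhaustion of the Heisenberg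
group by compact open subgroups (★ `UnitaryGroup.exists_compactOpen_subgroups_exhausting_unipotentU_three`, on the one-place MODEL `U(σ_w, Φ₃)(L_w)`)
is PULLED BACK along the one-place model ★ `localNonsplitEquiv : U(Φ₃)(L⁺_v) ≃ₜ* U(σ_w, Φ₃)(L_w)`, which matches the radicals (★
`localNonsplitEquiv_mem_unipotentU_iff`) — topology only [PlatonovRapinchuk1994 §5.1; Rogawski1990 §1.10 p. 9, §12.2 p. 173; HarishChandra1970 Part I §3].

* §1 **`exists_compactOpen_subgroups_exhausting_cmBorelTriple_N`** — `(cmBorelTriple L 3 v).N` is an increasing union of compact open subgroups.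
* §2 **`integral_dual_apply_cmBorelTriple_N_eq_zero_of_isSupercuspidal`** — the head at `Gqs L v`.

## References
* [HarishChandra1970] Harish-Chandra (notes by G. van Dijk), *Harmonic Analysis on Reductive p-adic Groups*, LNM 162 (1970), Part I §3.
* [Rogawski1990] J. D. Rogawski, *Automorphic Representations of Unitary Groups in Three Variables*, Ann. of Math. Stud. 123 (1990), §1.10 p. 9; §12.2 p. 173.
* [Casselman1995] W. Casselman, *Introduction to the theory of admissible representations of p-adic reductive groups* (1995), Thm. 5.3.1.
* [PlatonovRapinchuk1994] V. Platonov, A. Rapinchuk, *Algebraic Groups and Number Theory* (1994), §5.1.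
-/

set_option autoImplicit false

noncomputable section

open MeasureTheory Measure Set Filter Topology ValuativeRel
open scoped MatrixGroups Pointwise Topology

namespace Literature.NumberTheory.Rogawski1990

open Literature.NumberTheory.Automorphic Literature.NumberTheory.Automorphic.UnitaryGroup
open _root_.NumberField _root_.IsDedekindDomain

variable (L : Type) [Field L] [NumberField L] [IsCMField L]

/-! ## §1 The radical `N ≤ U(Φ₃)(L⁺_v)` is an increasing union of compact open subgroups (pull-back along the one-place model) -/

set_option maxHeartbeats 1600000 in
set_option synthInstance.maxHeartbeats 400000 in
-- instance-term unification on the CM local carriers (as in ★ `UnitaryGroupTorusOrbitalIntegralCanonical`)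
/-- **`N(L⁺_v) = (cmBorelTriple L 3 v).N` IS AN INCREASING UNION OF COMPACT OPEN SUBGROUPS** at a non-split `v`: pull back the model's
exhaustion (★ `exists_compactOpen_subgroups_exhausting_unipotentU_three` on `U(σ_w, Φ₃)(L_w)`, with the `σ_w`-fixed `ϖ = y σ_w(y)` of a uniformiser
`y` of `L_w`) along ★ `localNonsplitEquiv`, which matches the radicals. [cite: Rogawski1990, §1.10 p. 9] [cite: PlatonovRapinchuk1994, §5.1]
[cite: Casselman1995, Prop. 1.4.4] -/
theorem exists_compactOpen_subgroups_exhausting_cmBorelTriple_N (v : HeightOneSpectrum (𝓞 ↥(maximalRealSubfield L)))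
    (hns : ∀ w : PlacesOver L v, IsCMField.complexConj L • w.1 = w.1) :
    ∃ Nj : ℕ → Subgroup ↥(cmBorelTriple L 3 v).N, Monotone Nj ∧ (∀ j, IsCompact (Nj j : Set ↥(cmBorelTriple L 3 v).N)) ∧
      (∀ j, IsOpen (Nj j : Set ↥(cmBorelTriple L 3 v).N)) ∧ ∀ n : ↥(cmBorelTriple L 3 v).N, ∃ j, n ∈ Nj j := by
  classical
  obtain ⟨w⟩ := (inferInstance : Nonempty (PlacesOver L v))
  have hw := hns w
  haveI : CharZero (w.1.adicCompletion L) := charZero_of_injective_algebraMap (algebraMap L (w.1.adicCompletion L)).injective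
  -- the one-place model and its data (as in ★ `u3_isSupercuspidal_iff_jacquet_eq_zero_mp`)
  set e := localNonsplitEquiv (IsCMField.complexConj L) (Rogawski1990.qsForm L) (IsCMField.complexConj_ne_one L) w hw with he
  have hJw : placeForm (Rogawski1990.qsForm L) w.1 = (StdForm.antidiagonal 3).over (w.1.adicCompletion L) := by
    rw [placeForm, Rogawski1990.qsForm, antidiagOne_eq_over, StdForm.over_map]
  have hσσ : ∀ x, galAdicCompletionMap (L := L) (IsCMField.complexConj L) hw (galAdicCompletionMap (L := L) (IsCMField.complexConj L) hw x) = x :=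
    galAdicCompletionMap_galAdicCompletionMap_of_smul_eq (IsCMField.complexConj L) w (IsCMField.complexConj_ne_one L) hw
  obtain ⟨y, hy⟩ := exists_isUniformizingElement (F := w.1.adicCompletion L)
  have hσv : valuation (w.1.adicCompletion L) (galAdicCompletionMap (L := L) (IsCMField.complexConj L) hw y) = valuation (w.1.adicCompletion L) y := by
    have h := valued_galAdicCompletionMap (L := L) (IsCMField.complexConj L) hw y
    rw [le_antisymm_iff, ← Valuation.vle_iff_le (Valued.v : Valuation (w.1.adicCompletion L) _),
      ← Valuation.vle_iff_le (Valued.v : Valuation (w.1.adicCompletion L) _)] at h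
    rw [le_antisymm_iff, ← Valuation.vle_iff_le (valuation (w.1.adicCompletion L)), ← Valuation.vle_iff_le (valuation (w.1.adicCompletion L))]
    exact h
  have hϖ0 : y * galAdicCompletionMap (L := L) (IsCMField.complexConj L) hw y ≠ 0 :=
    mul_ne_zero hy.ne_zero ((map_ne_zero_iff _ (galAdicCompletionMap (L := L) (IsCMField.complexConj L) hw).injective).2 hy.ne_zero)
  have hϖ1 : valuation (w.1.adicCompletion L) (y * galAdicCompletionMap (L := L) (IsCMField.complexConj L) hw y) < 1 := by
    rw [map_mul, hσv]
    exact mul_lt_one_of_nonneg_of_lt_one_left zero_le hy.valuation_lt_one hy.valuation_lt_one.le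
  have hσϖ : galAdicCompletionMap (L := L) (IsCMField.complexConj L) hw (y * galAdicCompletionMap (L := L) (IsCMField.complexConj L) hw y) =
      y * galAdicCompletionMap (L := L) (IsCMField.complexConj L) hw y := by
    rw [map_mul, hσσ, mul_comm]
  -- the model restricted to the radicals: `eN : N(L⁺_v) →* N(L_w)`, a homeomorphic isomorphism
  set N' := unipotentU (galAdicCompletionMap (L := L) (IsCMField.complexConj L) hw) (placeForm (Rogawski1990.qsForm L) w.1) with hN'
  have hmem : ∀ g : ↥(unitaryGroupOfForm (conjLocal L (IsCMField.complexConj L) v) (cmLocalForm L 3 v)), e g ∈ N' ↔ g ∈ (cmBorelTriple L 3 v).N := fun g => by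
    rw [he]; exact localNonsplitEquiv_mem_unipotentU_iff L v w hw g
  set eN : ↥(cmBorelTriple L 3 v).N →* ↥N' :=
    { toFun := fun n => ⟨e (n : ↥(unitaryGroupOfForm (conjLocal L (IsCMField.complexConj L) v) (cmLocalForm L 3 v))), (hmem (n : ↥(unitaryGroupOfForm (conjLocal L (IsCMField.complexConj L) v) (cmLocalForm L 3 v)))).2 n.2⟩
      map_one' := Subtype.ext (by
        show e ((1 : ↥(cmBorelTriple L 3 v).N) : ↥(unitaryGroupOfForm (conjLocal L (IsCMField.complexConj L) v) (cmLocalForm L 3 v))) = ((1 : ↥N') : ↥(unitaryGroupOfForm _ _))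
        rw [OneMemClass.coe_one, OneMemClass.coe_one]
        exact map_one e)
      map_mul' := fun a b => Subtype.ext (by
        show e ((a * b : ↥(cmBorelTriple L 3 v).N) : ↥(unitaryGroupOfForm (conjLocal L (IsCMField.complexConj L) v) (cmLocalForm L 3 v))) = e (a : ↥(unitaryGroupOfForm (conjLocal L (IsCMField.complexConj L) v) (cmLocalForm L 3 v))) * e (b : ↥(unitaryGroupOfForm (conjLocal L (IsCMField.complexConj L) v) (cmLocalForm L 3 v)))
        rw [MulMemClass.coe_mul]
        exact map_mul e _ _) } with heN
  have heN_apply : ∀ n : ↥(cmBorelTriple L 3 v).N, ((eN n : ↥N') : _) = e (n : ↥(unitaryGroupOfForm (conjLocal L (IsCMField.complexConj L) v) (cmLocalForm L 3 v))) := fun n => rfl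
  have heNc : Continuous eN := by
    show Continuous (fun n : ↥(cmBorelTriple L 3 v).N => (⟨e (n : ↥(unitaryGroupOfForm (conjLocal L (IsCMField.complexConj L) v) (cmLocalForm L 3 v))), (hmem (n : ↥(unitaryGroupOfForm (conjLocal L (IsCMField.complexConj L) v) (cmLocalForm L 3 v)))).2 n.2⟩ : ↥N'))
    exact Continuous.subtype_mk (e.continuous.comp continuous_subtype_val) _
  -- its inverse on `N'`
  set dN : ↥N' → ↥(cmBorelTriple L 3 v).N := fun m => ⟨e.symm m, (hmem _).1 (by rw [ContinuousMulEquiv.apply_symm_apply]; exact m.2)⟩ with hdN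
  have hdNc : Continuous dN := Continuous.subtype_mk (e.symm.continuous.comp continuous_subtype_val) _
  have hdN_eN : ∀ n, dN (eN n) = n := fun n => Subtype.ext (by simp [hdN, heN_apply])
  have heN_dN : ∀ m, eN (dN m) = m := fun m => Subtype.ext (by simp [hdN, heN_apply])
  obtain ⟨Mj, hmono, hc, ho, hex⟩ := exists_compactOpen_subgroups_exhausting_unipotentU_three
    (galAdicCompletionMap (L := L) (IsCMField.complexConj L) hw) hJw (continuous_galAdicCompletionMap (L := L) (IsCMField.complexConj L) hw) hϖ0 hϖ1 hσϖ
  refine ⟨fun j => (Mj j).comap eN, ?_, ?_, ?_, ?_⟩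
  · intro i j hij n hn
    exact Subgroup.mem_comap.2 (hmono hij (Subgroup.mem_comap.1 hn))
  · -- compact: the preimage under `eN` is the image under `dN` of the compact `Mj j`
    intro j
    show IsCompact ((Mj j).comap eN : Set ↥(cmBorelTriple L 3 v).N)
    have heq : ((Mj j).comap eN : Set ↥(cmBorelTriple L 3 v).N) = dN '' (Mj j : Set ↥N') := by
      ext n
      simp only [SetLike.mem_coe, Subgroup.mem_comap, mem_image]
      constructor
      · exact fun hn => ⟨eN n, hn, hdN_eN n⟩
      · rintro ⟨m, hm, rfl⟩
        rw [heN_dN]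
        exact hm
    rw [heq]
    exact (hc j).image hdNc
  · intro j
    show IsOpen ((Mj j).comap eN : Set ↥(cmBorelTriple L 3 v).N)
    rw [Subgroup.coe_comap]
    exact (ho j).preimage heNc
  · intro n
    obtain ⟨j, hj⟩ := hex (eN n)
    exact ⟨j, Subgroup.mem_comap.2 hj⟩

/-! ## §2 The head at `Gqs L v` -/

set_option maxHeartbeats 1600000 in
set_option synthInstance.maxHeartbeats 400000 in
-- instance-term unification on the CM local carriers
/-- **MATRIX COEFFICIENTS OF SUPERCUSPIDAL REPRESENTATIONS OF `U(Φ₃)(L⁺_v)` ARE SUPERCUSP FORMS (non-split `v`).**  For an irreducible smooth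
representation `r` of `Gqs L v = U(Φ₃)(L⁺_v)` whose class is supercuspidal (★ `IrrClass.IsSupercuspidal`), a Borel right-invariant measure `μ` finite
on compacta on the radical `N = (cmBorelTriple L 3 v).N` of the Borel subgroup (e.g. any Haar measure — `N` is unimodular), a linear form `φ`, a vector
`w` and `a, b ∈ U(Φ₃)(L⁺_v)` (typed on the `unitaryGroupOfForm (conjLocal L c v) (cmLocalForm L 3 v)` spelling of `Gqs L v`, ★ `cmDatum_Local_eq`): if `n ↦ φ(r(a n b) w)` is integrable then `∫_N φ(r(a n b) w) dμ(n) = 0`.  Inputs: `V = V(N)` (★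
`u3_isSupercuspidal_iff_jacquet_eq_zero_mp`), §1, and the generic ★ `integral_dual_apply_eq_zero_of_mem_span_of_exhaustion`.
[cite: HarishChandra1970, Part I §3] [cite: Casselman1995, Thm. 5.3.1] [cite: Rogawski1990, §12.2 p. 173; §1.10 p. 9] -/
theorem integral_dual_apply_cmBorelTriple_N_eq_zero_of_isSupercuspidal (v : HeightOneSpectrum (𝓞 ↥(maximalRealSubfield L)))
    (hns : ∀ w : PlacesOver L v, IsCMField.complexConj L • w.1 = w.1)
    (r : SmoothIrrep ↥(unitaryGroupOfForm (conjLocal L (IsCMField.complexConj L) v) (cmLocalForm L 3 v))) (hr : (IrrClass.mk r).IsSupercuspidal)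
    [MeasurableSpace ↥(cmBorelTriple L 3 v).N] [BorelSpace ↥(cmBorelTriple L 3 v).N]
    (μ : Measure ↥(cmBorelTriple L 3 v).N) [IsFiniteMeasureOnCompacts μ] [μ.IsMulRightInvariant]
    (φ : Module.Dual ℂ r.V) (w : r.V) (a b : ↥(unitaryGroupOfForm (conjLocal L (IsCMField.complexConj L) v) (cmLocalForm L 3 v)))
    (hi : Integrable (fun n : ↥(cmBorelTriple L 3 v).N => φ (r.ρ (a * (n : ↥(unitaryGroupOfForm (conjLocal L (IsCMField.complexConj L) v) (cmLocalForm L 3 v))) * b) w)) μ) :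
    ∫ n : ↥(cmBorelTriple L 3 v).N, φ (r.ρ (a * (n : ↥(unitaryGroupOfForm (conjLocal L (IsCMField.complexConj L) v) (cmLocalForm L 3 v))) * b) w) ∂μ = 0 := by
  -- `V = V(N)` (★ Harish-Chandra's criterion ⇒; `r` read on the `Gqs L v` spelling by `rfl`, ★ `cmDatum_Local_eq`)
  haveI hsub : Subsingleton ((cmBorelTriple L 3 v).restrict r.ρ).Coinvariants := u3_isSupercuspidal_iff_jacquet_eq_zero_mp L v hns r hr
  have hker : r.ρ b w ∈ Submodule.span ℂ (Set.range fun p : ↥(cmBorelTriple L 3 v).N × r.V => r.ρ (p.1 : ↥(unitaryGroupOfForm (conjLocal L (IsCMField.complexConj L) v) (cmLocalForm L 3 v))) p.2 - p.2) := by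
    have h0 : Representation.Coinvariants.mk ((cmBorelTriple L 3 v).restrict r.ρ) (r.ρ b w) = 0 := Subsingleton.elim _ _
    rw [Representation.Coinvariants.mk_eq_zero] at h0
    refine (Submodule.span_le.2 ?_) h0
    rintro _ ⟨⟨q, x⟩, rfl⟩
    exact Submodule.subset_span ⟨(⟨((q : ↥(cmBorelTriple L 3 v).P) : ↥(unitaryGroupOfForm (conjLocal L (IsCMField.complexConj L) v) (cmLocalForm L 3 v))), Subgroup.mem_subgroupOf.1 q.2⟩, x), rfl⟩
  obtain ⟨Nj, hmono, hc, ho, hex⟩ := exists_compactOpen_subgroups_exhausting_cmBorelTriple_N L v hns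
  have e1 : ∀ n : ↥(cmBorelTriple L 3 v).N, φ (r.ρ (a * (n : ↥(unitaryGroupOfForm (conjLocal L (IsCMField.complexConj L) v) (cmLocalForm L 3 v))) * b) w) = φ (r.ρ (a * (n : ↥(unitaryGroupOfForm (conjLocal L (IsCMField.complexConj L) v) (cmLocalForm L 3 v)))) (r.ρ b w)) := fun n => by
    rw [show r.ρ (a * (n : ↥(unitaryGroupOfForm (conjLocal L (IsCMField.complexConj L) v) (cmLocalForm L 3 v))) * b) = r.ρ (a * (n : ↥(unitaryGroupOfForm (conjLocal L (IsCMField.complexConj L) v) (cmLocalForm L 3 v)))) * r.ρ b from map_mul r.ρ _ _]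
    rfl
  simp_rw [e1] at hi ⊢
  exact integral_dual_apply_eq_zero_of_mem_span_of_exhaustion r.ρ (cmBorelTriple L 3 v).N μ r.isSmooth hker Nj hmono hc ho hex φ a hi

end Literature.NumberTheory.Rogawski1990

end
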